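import Summits.HodgeConjecture.HodgeConjecture.Theorems.F0P3aStubS2LocallyQuasiSplit
import Summits.HodgeConjecture.HodgeConjecture.Theorems.F0P3aStubS1TraceFunctional
import Literature.NumberTheory.Automorphic.AdelicUnitaryGroupUnimodular
import Literature.NumberTheory.Automorphic.AdelicUnitaryGroupMeasure
import Literature.NumberTheory.Automorphic.GLnIwasawaIntegration
import HarnessLib

/-!
# ENGINE T1 line `F0_T1InnerFormTraceIdentity` (crux H413): stubs S1 and S2 EXERCISED at the definite form `H = 1`

Cell `hodgecm-mathlib`, floor 0, sub-programme P3a; referee request R1 (ii) «vacuity audit of S1–S3» (F0P3a-ref1 (g0),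
2026-08-30T23:03Z).  The two registered stubs that carry hypotheses,

* S1 `StubT1aTraceFunctional L H μ ν` (★ closed by `F0P3aStubS1TraceFunctional.stubS1_holds`) — instance binders
  `[MeasurableSpace] [BorelSpace]` on `U(H)(𝔸_{L⁺})`, an automorphic `μ`, an inversion-invariant Haar `ν`, hypothesis
  «`H` anisotropic»;
* S2 `StubT1gLocallyQuasiSplit L H` (★ closed by `F0P3aStubS2LocallyQuasiSplit.stubT1gLocallyQuasiSplit_holds`) —
  hypotheses «`H` anisotropic» and «`H` hermitian»,

are shown NON-VACUOUS by instantiating them at Rogawski's actual inner form of §14: the DEFINITE unitary group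
`G′ = U(3) = U(1₃)` (`H = 1`, [Rogawski1990, §14.1–14.2]: `G′_∞` compact, `G′_v ≅ G_v` at every finite `v`):

* `anisotropic_one`, `isHermitian_one` — `1₃` is anisotropic (`Σ x̄ᵢ xᵢ = 0 ⇒ x = 0`, positive definite at any complex
  embedding, ★ `UnitaryGroup.anisotropic_of_posDef_map`) and hermitian: BOTH hypotheses hold for one and the same `H`;
* **`stubS2_at_one`** — hence `U(3)(L⁺_v) ≃ₜ* U(Φ₃)(L⁺_v)` at EVERY finite place `v` (S2's conclusion exercised on a
  form that is NOT the split one: the definite and the quasi-split unitary groups in three variables are locally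
  isomorphic at all finite places — the content of [Rogawski1990, §14.2 (i)–(iii)] for `D = M₃(E)`, `S = ∅`);
* **`stubS1_at_one`** — the instance∕measure binders of S1 are INHABITED for `U(3)`: Borel σ-algebra, an automorphic
  measure (★ `UnitaryGroup.exists_isAutomorphicMeasure_cmDatum`, compact quotient), the Haar measure `haar`, which is
  inversion invariant because `U(H)(𝔸_{L⁺})` is unimodular in rank `3` (★ `isMulRightInvariant_adelicUnitaryGroup_three`,
  ★ `isInvInvariant_of_isMulRightInvariant`) — and for them the S1 clause holds (★ `stubS1_holds`): a `ℂ`-linear trace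
  functional reproducing the Hilbert–Schmidt norms `Σ_i ‖R(f′) e_i‖²` exists for the genuine `G′`.

S3 (`StubT1cSplitFormAutomorphicMeasure`) has no hypothesis to audit.  Theorems only; no `sorry`; nothing here closes a
stub (lane `--supports`).  HONEST LABEL: HC_CM is proved only modulo the printed citations until rung 0 closes.
-/

set_option autoImplicit false
-- the cell's namespace `Summit.HodgeConjecture.HodgeConjecture.…` (summit = problem) repeats a component by design
set_option linter.dupNamespace false

noncomputable section

namespace Summit.HodgeConjecture.HodgeConjecture.Cruxes.H413.F0P3aStubsAtDefiniteForm

open MeasureTheory Measure NumberField IsDedekindDomain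
open Literature.NumberTheory.Automorphic
open Literature.AlgebraicGeometry.ShimuraVarieties (hermForm)
open scoped ComplexOrder

variable (L : Type) [Field L] [NumberField L] [IsCMField L]

/-- **`1₃` is anisotropic**: `⟪x, x⟫_{1} = Σ x̄ᵢ xᵢ = 0 ⇒ x = 0` over a CM field (positive definite at any complex
embedding; ★ `UnitaryGroup.anisotropic_of_posDef_map`).  This is the S1∕S2 hypothesis «anisotropic» at Rogawski's
`G′ = U(3)`. [cite: Rogawski1990, §14.1 p. 232] -/
theorem anisotropic_one : ∀ x : Fin 3 → L, hermForm (cmConjRingHom L) (1 : Matrix (Fin 3) (Fin 3) L) x x = 0 → x = 0 := by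
  obtain ⟨τ⟩ := (inferInstance : Nonempty (L →+* ℂ))
  refine UnitaryGroup.anisotropic_of_posDef_map L (1 : Matrix (Fin 3) (Fin 3) L) τ ?_
  rw [Matrix.map_one τ (map_zero τ) (map_one τ)]
  exact Matrix.PosDef.one

/-- **`1₃` is hermitian** for the CM conjugation: `ᵗ(1̄) = 1` (the S2 hypothesis «hermitian» at `G′ = U(3)`).
[cite: Rogawski1990, §14.1 p. 232] -/
theorem isHermitian_one : ((1 : Matrix (Fin 3) (Fin 3) L).map (cmConjRingHom L)).transpose = 1 := by
  rw [Matrix.map_one (cmConjRingHom L) (map_zero _) (map_one _), Matrix.transpose_one]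

/-- **S2 exercised at the definite form: `U(3)(L⁺_v) ≃ₜ* U(Φ₃)(L⁺_v)` at every finite place `v` of `L⁺`** — the
conclusion of ★ `stubT1gLocallyQuasiSplit_holds` at `H = 1`, whose two hypotheses hold simultaneously (`anisotropic_one`,
`isHermitian_one`); `Φ₃ = antidiag(1,1,1)` is the line's literal split form.  [Rogawski1990, §14.2 (i)–(iii)]: for
`D = M₃(E)` the definite `G′` is locally the quasi-split `G` at all finite places. [cite: Rogawski1990, §14.2 p. 232] -/
theorem stubS2_at_one (v : HeightOneSpectrum (𝓞 ↥(maximalRealSubfield L))) :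
    Nonempty ((UnitaryGroup.cmDatum L 3 (1 : Matrix (Fin 3) (Fin 3) L)).Local v ≃ₜ*
      (UnitaryGroup.cmDatum L 3 (Matrix.of fun i j : Fin 3 => if i.val + j.val + 1 = 3 then (1 : L) else 0)).Local v) :=
  F0P3aStubS2LocallyQuasiSplit.stubT1gLocallyQuasiSplit_holds L 1 (anisotropic_one L) (isHermitian_one L) v

/-- **S1 exercised at the definite form**: for `G′ = U(3)` the binders of `StubT1aTraceFunctional` are inhabited — the
Borel σ-algebra on `U(3)(𝔸_{L⁺})`, an automorphic measure `μ` (★ `exists_isAutomorphicMeasure_cmDatum`), the Haar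
measure `ν = haar`, inversion invariant since `U(H)(𝔸_{L⁺})` is unimodular in rank `3` (★
`isMulRightInvariant_adelicUnitaryGroup_three` + ★ `isInvInvariant_of_isMulRightInvariant`) — and the S1 clause holds for
them (★ `stubS1_holds`): there is a `ℂ`-linear `θ` on `C_c(U(3)(𝔸_{L⁺}))` with `Σ_i ‖R(f′) e_i‖² = Re θ(f′ ⋆ f′^*)`,
`Im θ(f′ ⋆ f′^*) = 0`. [cite: Rogawski1990, §14.5 p. 237] [cite: Gelbart1975, Lemma 10.6] -/
theorem stubS1_at_one :
    ∃ (_ : MeasurableSpace (UnitaryGroup.cmDatum L 3 (1 : Matrix (Fin 3) (Fin 3) L)).Adelic)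
      (_ : BorelSpace (UnitaryGroup.cmDatum L 3 (1 : Matrix (Fin 3) (Fin 3) L)).Adelic)
      (μ : Measure (UnitaryGroup.cmDatum L 3 (1 : Matrix (Fin 3) (Fin 3) L)).automorphicQuotient)
      (_ : (UnitaryGroup.cmDatum L 3 (1 : Matrix (Fin 3) (Fin 3) L)).IsAutomorphicMeasure μ)
      (ν : Measure (UnitaryGroup.cmDatum L 3 (1 : Matrix (Fin 3) (Fin 3) L)).Adelic)
      (_ : ν.IsHaarMeasure) (_ : ν.IsInvInvariant),
      ∃ θ : CompactlySupportedContinuousMap (UnitaryGroup.cmDatum L 3 (1 : Matrix (Fin 3) (Fin 3) L)).Adelic ℂ →ₗ[ℂ] ℂ,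
        ∀ (f' F' : CompactlySupportedContinuousMap (UnitaryGroup.cmDatum L 3 (1 : Matrix (Fin 3) (Fin 3) L)).Adelic ℂ),
          (∀ x, F' x = mulConv ν (⇑f') (mulStar (⇑f')) x) →
          ∀ {ι : Type} [Countable ι]
            (b : HilbertBasis ι ℂ ((UnitaryGroup.cmDatum L 3 (1 : Matrix (Fin 3) (Fin 3) L)).L2 μ)),
            HasSum (fun i => (‖((UnitaryGroup.cmDatum L 3 (1 : Matrix (Fin 3) (Fin 3) L)).rightRegular μ).integratedOperator
                ((UnitaryGroup.cmDatum L 3 (1 : Matrix (Fin 3) (Fin 3) L)).isUnitary_rightRegular μ)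
                ((UnitaryGroup.cmDatum L 3 (1 : Matrix (Fin 3) (Fin 3) L)).isStronglyContinuous_rightRegular_holds μ)
                ν f' (b i)‖ ^ 2 : ℝ))
              (θ F').re ∧ (θ F').im = 0 := by
  -- `(cmDatum L 3 1).Adelic` is `↥(adelicUnitaryGroup L 1)` by `rfl`; the instances are named and passed explicitly
  letI mA : MeasurableSpace (UnitaryGroup.cmDatum L 3 (1 : Matrix (Fin 3) (Fin 3) L)).Adelic := borel _
  haveI bA : BorelSpace (UnitaryGroup.cmDatum L 3 (1 : Matrix (Fin 3) (Fin 3) L)).Adelic := ⟨rfl⟩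
  obtain ⟨μ, hμ⟩ := UnitaryGroup.exists_isAutomorphicMeasure_cmDatum L 3 1 (anisotropic_one L)
  set ν : Measure (UnitaryGroup.cmDatum L 3 (1 : Matrix (Fin 3) (Fin 3) L)).Adelic := haar with hν
  have hνH : ν.IsHaarMeasure := by rw [hν]; infer_instance
  haveI : ν.IsMulRightInvariant :=
    @UnitaryGroup.isMulRightInvariant_adelicUnitaryGroup_three L _ _ _ 1 (isHermitian_one L) (by simp) mA bA ν hνH
  haveI : ν.IsInvInvariant := isInvInvariant_of_isMulRightInvariant ν
  exact ⟨_, inferInstance, μ, hμ, ν, hνH, inferInstance,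
    F0P3aStubS1TraceFunctional.stubS1_holds L 1 μ ν (anisotropic_one L)⟩

end Summit.HodgeConjecture.HodgeConjecture.Cruxes.H413.F0P3aStubsAtDefiniteForm

end
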